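import Literature.Geometry.DiscreteGeometry.DelsarteLinearProgrammingBound

/-!
# The simplex bound `A(n, -1/n) ≤ n + 1` from the linear programming bound (all `n ≥ 3`)

Framing: lottery ticket; floor = certified bounds/negative ranges. Venture `PackingBounds`
(cell `pub-packcert`), spherical-code family, + control "simplex" in closed form for every dimension.

**Theorem.** Let `n ≥ 3`. Every finite set of unit vectors of `ℝⁿ` with pairwise inner products
`≤ -1/n` has at most `n + 1` elements (attained by the regular simplex). Proof: the degree-one
Delsarte certificate `f(t) = t + 1/n = (1/n)·C_0 + (1/(2μ))·C_1^{μ}(t)` (`μ = (n-2)/2`,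
`C_1^{μ}(t) = 2μt`), nonpositive on `[-1, -1/n]`, with `f(1)/f_0 = (1 + 1/n)/(1/n) = n + 1` — a
symbolic-in-`n` instance of `Literature.Geometry.DiscreteGeometry.DelsarteLP.card_le`.
(The classical proof is `0 ≤ ‖Σ x_i‖² ≤ N - N(N-1)/n`; Rankin 1955. The orthoplex bound
`A(n, 0) ≤ 2n` is already in the tree: `card_le_two_mul_finrank_of_inner_nonpos`.)

## References
* P. Delsarte, J. M. Goethals, J. J. Seidel, Geom. Dedicata 6 (1977) 363–388 (Example: simplex). [`DelsarteGoethalsSeidel1977`]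
* J. H. Conway, N. J. A. Sloane, *Sphere Packings, Lattices and Groups*, Ch. 1 §2.3, Ch. 9 §3. [`ConwaySloane1999`]
-/

namespace Summit.Ventures.PackingBounds.SphericalCodes

open Finset Literature.Analysis.SpecialFunctions Literature.Geometry.DiscreteGeometry

/-- **Simplex bound** (`n ≥ 3`): a finite set of unit vectors of `ℝⁿ` with pairwise inner products
`≤ -1/n` has at most `n + 1` elements; degree-one Delsarte LP certificate `f(t) = t + 1/n`.
[cite: DelsarteGoethalsSeidel1977, §4 (linear programming bound; simplex example)] -/
theorem simplex_card_le (n : ℕ) (hn : 3 ≤ n) (C : Finset (EuclideanSpace ℝ (Fin n)))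
    (h1 : ∀ x ∈ C, ‖x‖ = 1) (h2 : ∀ x ∈ C, ∀ y ∈ C, x ≠ y → inner ℝ x y ≤ -1 / (n : ℝ)) :
    C.card ≤ n + 1 := by
  have hn' : (3 : ℝ) ≤ n := by exact_mod_cast hn
  have hnpos : (0 : ℝ) < n := by linarith
  set μ : ℝ := ((n : ℝ) - 2) / 2 with hμdef
  have hμ : (0 : ℝ) < μ := by rw [hμdef]; linarith
  have hnμ : (n : ℝ) = 2 * μ + 2 := by rw [hμdef]; ring
  have key := DelsarteLP.card_le (n := n) (μ := μ) hnμ hμ 1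
    (fun k => match k with | 0 => 1 / (n : ℝ) | 1 => 1 / (2 * μ) | _ => 0)
    ?_ (-1 / (n : ℝ)) ?_ (n + 1) (by show (0 : ℝ) < 1 / (n : ℝ); positivity) ?_ C h1 h2
  · exact_mod_cast key
  · intro k
    split <;> positivity
  · intro t ht1 ht2
    simp only [Finset.sum_range_succ, Finset.sum_range_zero, zero_add, gegenbauerSum_zero,
      gegenbauerSum_one]
    have h2μ : (2 : ℝ) * μ ≠ 0 := by positivity
    have : 1 / (n : ℝ) * 1 + 1 / (2 * μ) * (2 * μ * t) = 1 / (n : ℝ) + t := by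
      field_simp
    rw [this]
    have : t ≤ -1 / (n : ℝ) := ht2
    have h3 : -1 / (n : ℝ) = -(1 / (n : ℝ)) := by ring
    linarith
  · simp only [Finset.sum_range_succ, Finset.sum_range_zero, zero_add, gegenbauerSum_zero,
      gegenbauerSum_one]
    have h2μ : (2 : ℝ) * μ ≠ 0 := by positivity
    have : 1 / (n : ℝ) * 1 + 1 / (2 * μ) * (2 * μ * 1) = 1 / (n : ℝ) + 1 := by
      field_simp
    rw [this]
    have hcast : ((n + 1 : ℕ) : ℝ) = (n : ℝ) + 1 := by push_cast; ring
    rw [hcast]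
    have : ((n : ℝ) + 1 + 1) * (1 / (n : ℝ)) = 1 / (n : ℝ) + 1 + 1 / (n : ℝ) := by
      field_simp; ring
    rw [this]
    have : (0 : ℝ) < 1 / (n : ℝ) := by positivity
    linarith

end Summit.Ventures.PackingBounds.SphericalCodes
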